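import Literature.Analysis.FluidPDE.PassiveScalarProofs
import Literature.Analysis.FunctionSpaces.TorusTrigPoly
import HarnessLib

/-!
# Fourier modes of weak solutions of the passive scalar equation on `T^d`

Analysis/FluidPDE support file. It serves the discharge of the energy inequality
`Literature.Analysis.FluidPDE.Torus.IsWeakScalarTransportOn.lintegral_sq_add_le` (`FluidPDE/PassiveScalar`; DEIJ 2022,
(1.2)–(1.3); Evans 2010, §7.1.2 Thm. 2) by the Fourier (Galerkin) method: a weak solution
`θ ∈ L^∞(0,T; L²(T^d))` of `∂ₜθ + u·∇θ = κΔθ` with datum `θ₀` (`Torus.IsWeakScalarTransportOn`,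
DiPerna–Lions 1989, §II.1 (12)–(14)) is tested against the separated test functions
`ψ(t, x) = η(t) Re (z e_{-k}(x))`, `η ∈ C_c^∞((-∞, T))`, `z ∈ {1, i}`, `k ∈ ℤ^d`, and the a.e.
du Bois-Reymond lemma with initial datum (`Literature.Analysis.FunctionSpaces.ae_eq_add_setIntegral_of_forall_test`,
`FunctionSpaces/DuBoisReymondAE`) turns the resulting distributional ODE into an integral
equation for the Fourier modes:

* `Torus.isSpaceTimeTest_mul`, `Torus.timeDeriv_mul` — product test functions `η(t) g(x)`;
* `Torus.partialDeriv_re_oneMode`, `Torus.laplacian_re_oneMode`, `Torus.inner_gradient_re_oneMode`,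
  `Torus.integral_mul_re_mul_mFourier`, `Torus.integral_mul_re_oneMode` — calculus of the
  one-mode test functions `Re (z e_{-k})` and the pairing `∫ f Re (z e_{-k}) = Re (z 𝓕f(k))`
  (Grafakos 2014, Prop. 3.2.6 (8): `∂ⱼ e_m = 2πi mⱼ e_m`);
* `IsWeakScalarTransportOn.setIntegral_test_mul` — **the weak formulation tested with
  `η(t) g(x)`**: `∫_{(0,T)} (η' ∫ θ g + η ∫ θ (⟪u, ∇g⟫ + κΔg)) + η(0) ∫ θ₀ g = 0`;
* `IsWeakScalarTransportOn.integrableOn_mFourierCoeff`,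
  `IsWeakScalarTransportOn.integrableOn_mFourierCoeff_mul_velocity` — the modes
  `t ↦ 𝓕θ(t)(k)` and `t ↦ 𝓕(θ uⱼ)(t)(k)` are integrable on `(0,T)` (Fubini);
* `IsWeakScalarTransportOn.ae_mFourierCoeff_eq` — **the modewise integral equation**: for every
  `k` and a.e. `t ∈ (0,T)`,
  `𝓕θ(t)(k) = 𝓕θ₀(k) + ∫_{(0,t]} (-4π²κ|k|² 𝓕θ(s)(k) - ∑ⱼ 2πi kⱼ 𝓕(θ uⱼ)(s)(k)) ds`
  (real and imaginary parts: `ae_re_mul_mFourierCoeff_eq`).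

Only the definition of a weak solution and `θ₀ ∈ L¹` are used (no bound on `u` beyond the
standing `u θ ∈ L¹`), so the modewise equation also covers pure transport `κ = 0`.

## Mathlib / tree search

Mathlib (this pin): characters `UnitAddTorus.mFourier`, coefficients `mFourierCoeff`
(`Mathlib/Analysis/Fourier/AddCircleMulti.lean`), `integral_re`/`integral_im`, Fubini
(`integral_prod`, `Integrable.integral_prod_left`). Tree: `TorusTrigPoly` (`trigPoly`,
`isSmooth_re_trigPoly`, `partialDeriv_re_trigPoly`, `inner_gradient_eq_sum_mul_partialDeriv`; the
proof pattern of `IsWeaklyDivFree.sum_mul_mFourierCoeff_eq_zero`), `TorusFourierCalculus`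
(`mFourierCoeff_eq_integral_volume`), `PassiveScalarProofs` (`integral_prod_weak_eq`,
`integrable_uncurry`, `integrable_norm_velocity_mul`, `gradient_const_mul`, `laplacian_const_mul`),
`DuBoisReymondAE`. No modewise form of a transport/heat weak formulation exists in either
(searched `mFourierCoeff` in `FluidPDE/`: only the Navier–Stokes Galerkin files, which start
from trigonometric-polynomial *solutions*, not from weak solutions).

## References

* R. J. DiPerna, P.-L. Lions, *Ordinary differential equations, transport theory and Sobolev
  spaces*, Invent. Math. 98 (1989), 511–547, §II.1, (12)–(14).
* L. C. Evans, *Partial Differential Equations*, 2nd ed. (AMS 2010), §7.1.2, (16)–(18) and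
  Thm. 2 (Galerkin approximation, energy estimates).
* T. D. Drivas, T. M. Elgindi, G. Iyer, I.-J. Jeong, *Anomalous dissipation in passive scalar
  transport*, Arch. Ration. Mech. Anal. 243 (2022), 1151–1180 (arXiv:1911.03271), (1.1)–(1.2)
  (arXiv numbering). Bib key `DrivasEtAl2022`.
* L. Grafakos, *Classical Fourier Analysis*, 3rd ed., GTM 249 (2014), Prop. 3.2.6 (8).
-/

noncomputable section

open MeasureTheory TopologicalSpace Set Function Filter Topology UnitAddTorus Complex
open scoped ENNReal NNReal InnerProductSpace ComplexConjugate ContDiff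

namespace Literature.Analysis.FluidPDE

namespace Torus

variable {d : Type*} [Fintype d]

/-! ## Product test functions `η(t) g(x)` -/

section ProductTest

/-- **Product test functions.** For a smooth compactly supported `η : ℝ → ℝ` with
`tsupport η ⊆ (-∞, T)` and a smooth `g : T^d → ℝ`, `ψ(t, x) = η(t) g(x)` is a space–time test
function on `T^d × [0, T)`. [folklore] -/
theorem isSpaceTimeTest_mul {T : ℝ} {η : ℝ → ℝ} (hη : ContDiff ℝ ∞ η)
    (hηc : HasCompactSupport η) (hηT : tsupport η ⊆ Iio T) {g : UnitAddTorus d → ℝ}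
    (hg : FunctionSpaces.Torus.IsSmooth g) : FunctionSpaces.Torus.IsSpaceTimeTest T (fun t x => η t * g x) := by
  refine ⟨?_, ?_⟩
  · have h : FunctionSpaces.Torus.stLift (fun t x => η t * g x) = fun p : ℝ × EuclideanSpace ℝ d => η p.1 * FunctionSpaces.Torus.lift g p.2 := by
      funext p; simp [FunctionSpaces.Torus.stLift, FunctionSpaces.Torus.lift]
    rw [h]
    exact (hη.comp contDiff_fst).mul ((hg : ContDiff ℝ ∞ (FunctionSpaces.Torus.lift g)).comp contDiff_snd)
  · obtain ⟨T', hT'T, hT'⟩ := FunctionSpaces.exists_lt_forall_eq_zero_of_tsupport_subset_Iio hηc hηT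
    exact ⟨T', hT'T, fun t ht => funext fun x => by simp [hT' t ht]⟩

omit [Fintype d] in
/-- Time derivative of a product test function: `∂ₜ(η g) = η' g`. [folklore] -/
theorem timeDeriv_mul (η : ℝ → ℝ) (g : UnitAddTorus d → ℝ) (t : ℝ) (x : UnitAddTorus d) :
    FunctionSpaces.Torus.timeDeriv (fun t x => η t * g x) t x = deriv η t * g x := by
  simp only [FunctionSpaces.Torus.timeDeriv]
  exact deriv_mul_const_field _

end ProductTest

/-! ## The one-mode scalar test functions `x ↦ Re (z e_{-k}(x))` -/

section OneMode

variable [DecidableEq d]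

omit [DecidableEq d] in
/-- `trigPoly {-k} (· ↦ z) x = z e_{-k}(x)`. [folklore] -/
theorem trigPoly_singleton_const (k : d → ℤ) (z : ℂ) (x : UnitAddTorus d) :
    FunctionSpaces.Torus.trigPoly {-k} (fun _ => z) x = z * mFourier (-k) x := by
  rw [FunctionSpaces.Torus.trigPoly_apply, Finset.sum_singleton, smul_eq_mul, mul_comm]

/-- Partial derivatives of the one-mode test function:
`∂ⱼ Re (z e_{-k}) = Re (-(2πi kⱼ) z e_{-k})`. [folklore] -/
theorem partialDeriv_re_oneMode (k : d → ℤ) (z : ℂ) (j : d) (x : UnitAddTorus d) :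
    FunctionSpaces.Torus.partialDeriv j (fun y : UnitAddTorus d => (FunctionSpaces.Torus.trigPoly {-k} (fun _ => z) y).re) x =
      (-(2 * Real.pi * I * (k j)) * z * mFourier (-k) x).re := by
  rw [FunctionSpaces.Torus.partialDeriv_re_trigPoly, FunctionSpaces.Torus.trigPoly_apply, Finset.sum_singleton]
  simp only [Pi.neg_apply, Int.cast_neg, smul_eq_mul]
  congr 1
  ring

/-- The Laplacian of the one-mode test function: `Δ Re (z e_{-k}) = Re (-4π²|k|² z e_{-k})`. [folklore] -/
theorem laplacian_re_oneMode (k : d → ℤ) (z : ℂ) (x : UnitAddTorus d) :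
    FunctionSpaces.Torus.laplacian (fun y : UnitAddTorus d => (FunctionSpaces.Torus.trigPoly {-k} (fun _ => z) y).re) x =
      (-((4 * Real.pi ^ 2 * FunctionSpaces.Torus.freqNormSq k : ℝ) : ℂ) * z * mFourier (-k) x).re := by
  rw [FunctionSpaces.Torus.laplacian_eq_sum_partialDeriv_partialDeriv (FunctionSpaces.Torus.isSmooth_re_trigPoly _ _)]
  have h : ∀ j : d, FunctionSpaces.Torus.partialDeriv j (FunctionSpaces.Torus.partialDeriv j
      (fun y : UnitAddTorus d => (FunctionSpaces.Torus.trigPoly {-k} (fun _ => z) y).re)) x =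
      ((2 * Real.pi * I * (k j)) ^ 2 * z * mFourier (-k) x).re := by
    intro j
    have e : FunctionSpaces.Torus.partialDeriv j (fun y : UnitAddTorus d => (FunctionSpaces.Torus.trigPoly {-k} (fun _ => z) y).re) =
        fun y : UnitAddTorus d => (FunctionSpaces.Torus.trigPoly {-k} (fun k' => (2 * Real.pi * I * (k' j)) • z) y).re :=
      funext fun y => FunctionSpaces.Torus.partialDeriv_re_trigPoly _ _ _ _
    rw [e, FunctionSpaces.Torus.partialDeriv_re_trigPoly, FunctionSpaces.Torus.trigPoly_apply, Finset.sum_singleton]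
    simp only [Pi.neg_apply, Int.cast_neg, smul_eq_mul]
    congr 1
    ring
  simp_rw [h]
  rw [← Complex.re_sum, ← Finset.sum_mul, ← Finset.sum_mul]
  congr 3
  rw [FunctionSpaces.Torus.freqNormSq]
  push_cast
  rw [Finset.mul_sum, ← Finset.sum_neg_distrib]
  refine Finset.sum_congr rfl fun i _ => ?_
  linear_combination ((2 : ℂ) * Real.pi * (k i : ℂ)) ^ 2 * I_mul_I

/-- The transport pairing against the one-mode test function:
`⟪v, ∇ Re (z e_{-k})(x)⟫ = Re (-(2πi) (∑ⱼ kⱼ vⱼ) z e_{-k}(x))`. [folklore] -/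
theorem inner_gradient_re_oneMode (k : d → ℤ) (z : ℂ) (v : EuclideanSpace ℝ d) (x : UnitAddTorus d) :
    ⟪v, FunctionSpaces.Torus.gradient (fun y : UnitAddTorus d => (FunctionSpaces.Torus.trigPoly {-k} (fun _ => z) y).re) x⟫_ℝ =
      (∑ j, -(2 * Real.pi * I * (k j)) * (v j : ℂ) * z * mFourier (-k) x).re := by
  rw [FunctionSpaces.Torus.inner_gradient_eq_sum_mul_partialDeriv ((FunctionSpaces.Torus.isSmooth_re_trigPoly _ _).isContDiff (by simp)),
    Complex.re_sum]
  refine Finset.sum_congr rfl fun j _ => ?_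
  rw [partialDeriv_re_oneMode, ← Complex.re_ofReal_mul]
  congr 1
  ring

omit [DecidableEq d] in
/-- **Pairing a real function with a one-mode test function**: for integrable real `f` and
`w ∈ ℂ`, `∫ f(x) Re (w e_{-k}(x)) dx = Re (w 𝓕f(k))` (`𝓕f(k) = ∫ e_{-k} f` for the global
volume, `Torus.mFourierCoeff_eq_integral_volume`). [folklore] -/
theorem integral_mul_re_mul_mFourier {f : UnitAddTorus d → ℝ} (hf : Integrable f volume)
    (w : ℂ) (k : d → ℤ) :
    ∫ x, f x * (w * mFourier (-k) x).re = (w * mFourierCoeff (fun x => (f x : ℂ)) k).re := by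
  have hint : Integrable (fun x => w * (mFourier (-k) x * (f x : ℂ))) volume := by
    refine Integrable.const_mul ?_ _
    exact (ofRealCLM.integrable_comp hf).bdd_mul (c := 1) (mFourier (-k)).continuous.aestronglyMeasurable
      (Eventually.of_forall fun x => ((mFourier (-k)).norm_coe_le_norm x).trans_eq mFourier_norm)
  have hre := integral_re hint
  simp only [RCLike.re_to_complex] at hre
  rw [FunctionSpaces.Torus.mFourierCoeff_eq_integral_volume]
  simp only [smul_eq_mul]
  rw [← integral_const_mul, ← hre]
  refine integral_congr_ae (Eventually.of_forall fun x => ?_)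
  simp only [← Complex.re_ofReal_mul]
  congr 1
  ring

omit [DecidableEq d] in
/-- Pairing a real integrable function with the one-mode test function `Re (z e_{-k})`:
`∫ f Re (z e_{-k}) = Re (z 𝓕f(k))`. [folklore] -/
theorem integral_mul_re_oneMode {f : UnitAddTorus d → ℝ} (hf : Integrable f volume) (k : d → ℤ)
    (z : ℂ) :
    ∫ x, f x * (FunctionSpaces.Torus.trigPoly {-k} (fun _ => z) x).re = (z * mFourierCoeff (fun x => (f x : ℂ)) k).re := by
  simp_rw [trigPoly_singleton_const]
  exact integral_mul_re_mul_mFourier hf z k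

end OneMode

/-! ## Testing a weak solution with `η(t) g(x)` -/

section WeakTest

namespace IsWeakScalarTransportOn

variable {T κ : ℝ} {u : ℝ → UnitAddTorus d → EuclideanSpace ℝ d} {θ₀ : UnitAddTorus d → ℝ}
  {θ : ℝ → UnitAddTorus d → ℝ}

/-- Integrability on `(0,T) × T^d` of `θ(t,x) c(x)` for continuous `c`. [folklore] -/
theorem integrable_mul_continuous (h : IsWeakScalarTransportOn T κ u θ₀ θ)
    {c : UnitAddTorus d → ℝ} (hc : Continuous c) :
    Integrable (fun p : ℝ × UnitAddTorus d => θ p.1 p.2 * c p.2)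
      (((volume : Measure ℝ).restrict (Ioo 0 T)).prod volume) := by
  obtain ⟨C, hC⟩ := FunctionSpaces.Torus.exists_forall_norm_le_of_continuous hc
  exact h.integrable_uncurry.mul_bdd (hc.comp continuous_snd).aestronglyMeasurable
    (Eventually.of_forall fun p => hC p.2)

/-- Integrability on `(0,T) × T^d` of `θ(t,x) ⟪u(t,x), G(x)⟫` for continuous `G`
(`|θ ⟪u, G⟫| ≤ sup ‖G‖ · ‖u‖ |θ|` and `u θ ∈ L¹`). [folklore] -/
theorem integrable_mul_inner_continuous (h : IsWeakScalarTransportOn T κ u θ₀ θ)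
    {G : UnitAddTorus d → EuclideanSpace ℝ d} (hG : Continuous G) :
    Integrable (fun p : ℝ × UnitAddTorus d => θ p.1 p.2 * ⟪u p.1 p.2, G p.2⟫_ℝ)
      (((volume : Measure ℝ).restrict (Ioo 0 T)).prod volume) := by
  obtain ⟨C, hC⟩ := FunctionSpaces.Torus.exists_forall_norm_le_of_continuous hG
  have hm : AEStronglyMeasurable (fun p : ℝ × UnitAddTorus d => θ p.1 p.2 * ⟪u p.1 p.2, G p.2⟫_ℝ)
      (((volume : Measure ℝ).restrict (Ioo 0 T)).prod volume) :=
    h.aestronglyMeasurable_uncurry.mul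
      (h.aestronglyMeasurable_uncurry_velocity.inner (hG.comp continuous_snd).aestronglyMeasurable)
  refine (h.integrable_norm_velocity_mul.norm.const_mul C).mono' hm (Eventually.of_forall fun p => ?_)
  rw [norm_mul, Real.norm_eq_abs, Real.norm_eq_abs, norm_mul, norm_norm, Real.norm_eq_abs]
  calc |θ p.1 p.2| * |⟪u p.1 p.2, G p.2⟫_ℝ| ≤ |θ p.1 p.2| * (‖u p.1 p.2‖ * C) :=
        mul_le_mul_of_nonneg_left ((abs_real_inner_le_norm _ _).trans
          (mul_le_mul_of_nonneg_left (hC p.2) (norm_nonneg _))) (abs_nonneg _)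
    _ = C * (‖u p.1 p.2‖ * |θ p.1 p.2|) := by ring

/-- **The weak formulation tested with `η(t) g(x)`.** For a smooth compactly supported `η` with
`tsupport η ⊆ (-∞, T)` and a smooth `g : T^d → ℝ`,
`∫_{(0,T)} (η'(t) ∫ θ(t) g + η(t) ∫ θ(t) (⟪u(t), ∇g⟫ + κ Δg)) dt + η(0) ∫ θ₀ g = 0`
(DiPerna–Lions 1989, (14); Evans 2010, §7.1.1 (motivation of the weak formulation): separation
of the time and space test functions). [folklore] -/
theorem setIntegral_test_mul (h : IsWeakScalarTransportOn T κ u θ₀ θ) {η : ℝ → ℝ}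
    (hη : ContDiff ℝ ∞ η) (hηc : HasCompactSupport η) (hηT : tsupport η ⊆ Iio T)
    {g : UnitAddTorus d → ℝ} (hg : FunctionSpaces.Torus.IsSmooth g) :
    (∫ t in Ioo 0 T, ((deriv η t * ∫ x, θ t x * g x) +
      η t * ∫ x, θ t x * (⟪u t x, FunctionSpaces.Torus.gradient g x⟫_ℝ + κ * FunctionSpaces.Torus.laplacian g x))) +
      η 0 * ∫ x, θ₀ x * g x = 0 := by
  have hψ := isSpaceTimeTest_mul hη hηc hηT hg
  have hg1 : FunctionSpaces.Torus.IsContDiff 1 g := hg.isContDiff (by simp)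
  have key := integral_prod_weak_eq h hψ
  -- rewrite the weak integrand pointwise
  have hpt : ∀ p : ℝ × UnitAddTorus d, θ p.1 p.2 *
      (FunctionSpaces.Torus.timeDeriv (fun t x => η t * g x) p.1 p.2 +
        ⟪u p.1 p.2, FunctionSpaces.Torus.gradient ((fun t x => η t * g x) p.1) p.2⟫_ℝ +
        κ * FunctionSpaces.Torus.laplacian ((fun t x => η t * g x) p.1) p.2) =
      deriv η p.1 * (θ p.1 p.2 * g p.2) +
        η p.1 * (θ p.1 p.2 * (⟪u p.1 p.2, FunctionSpaces.Torus.gradient g p.2⟫_ℝ + κ * FunctionSpaces.Torus.laplacian g p.2)) := by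
    intro p
    rw [timeDeriv_mul, gradient_const_mul hg1, laplacian_const_mul hg, real_inner_smul_right]
    ring
  set P : Measure (ℝ × UnitAddTorus d) := ((volume : Measure ℝ).restrict (Ioo 0 T)).prod volume
    with hP
  obtain ⟨Ca, hCa⟩ := (hη.continuous_deriv (by simp)).bounded_above_of_compact_support hηc.deriv
  obtain ⟨Cb, hCb⟩ := hη.continuous.bounded_above_of_compact_support hηc
  set f₁ : ℝ × UnitAddTorus d → ℝ := fun p => deriv η p.1 * (θ p.1 p.2 * g p.2) with hf₁
  set f₂ : ℝ × UnitAddTorus d → ℝ := fun p =>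
    η p.1 * (θ p.1 p.2 * (⟪u p.1 p.2, FunctionSpaces.Torus.gradient g p.2⟫_ℝ + κ * FunctionSpaces.Torus.laplacian g p.2)) with hf₂
  have hI₁ : Integrable (fun p : ℝ × UnitAddTorus d => θ p.1 p.2 * g p.2) P :=
    h.integrable_mul_continuous hg.continuous
  have hI₂ : Integrable (fun p : ℝ × UnitAddTorus d =>
      θ p.1 p.2 * (⟪u p.1 p.2, FunctionSpaces.Torus.gradient g p.2⟫_ℝ + κ * FunctionSpaces.Torus.laplacian g p.2)) P := by
    have e : (fun p : ℝ × UnitAddTorus d =>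
        θ p.1 p.2 * (⟪u p.1 p.2, FunctionSpaces.Torus.gradient g p.2⟫_ℝ + κ * FunctionSpaces.Torus.laplacian g p.2)) =
        fun p => θ p.1 p.2 * ⟪u p.1 p.2, FunctionSpaces.Torus.gradient g p.2⟫_ℝ + θ p.1 p.2 * (κ * FunctionSpaces.Torus.laplacian g p.2) := by
      funext p; ring
    rw [e]
    exact (h.integrable_mul_inner_continuous hg.gradient.continuous).add
      (h.integrable_mul_continuous (continuous_const.mul hg.laplacian.continuous))
  have hf₁i : Integrable f₁ P :=
    hI₁.bdd_mul ((hη.continuous_deriv (by simp)).comp continuous_fst).aestronglyMeasurable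
      (Eventually.of_forall fun p => hCa p.1)
  have hf₂i : Integrable f₂ P :=
    hI₂.bdd_mul (hη.continuous.comp continuous_fst).aestronglyMeasurable
      (Eventually.of_forall fun p => hCb p.1)
  have esum : (∫ p, (f₁ p + f₂ p) ∂P) + η 0 * ∫ x, θ₀ x * g x = 0 := by
    have e1 : ∫ p, (f₁ p + f₂ p) ∂P = ∫ p, θ p.1 p.2 *
        (FunctionSpaces.Torus.timeDeriv (fun t x => η t * g x) p.1 p.2 +
          ⟪u p.1 p.2, FunctionSpaces.Torus.gradient ((fun t x => η t * g x) p.1) p.2⟫_ℝ +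
          κ * FunctionSpaces.Torus.laplacian ((fun t x => η t * g x) p.1) p.2) ∂P :=
      integral_congr_ae (Eventually.of_forall fun p => (hpt p).symm)
    have e2 : η 0 * ∫ x, θ₀ x * g x = ∫ x, θ₀ x * (fun t x => η t * g x) 0 x := by
      rw [← integral_const_mul]
      exact integral_congr_ae (Eventually.of_forall fun x => by simp only; ring)
    rw [e1, e2]
    exact key
  have e₁ : ∫ p, f₁ p ∂P = ∫ t in Ioo 0 T, deriv η t * ∫ x, θ t x * g x := by
    rw [hP, integral_prod _ hf₁i]
    refine integral_congr_ae (Eventually.of_forall fun t => ?_)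
    simp only [hf₁]
    exact integral_const_mul _ _
  have e₂ : ∫ p, f₂ p ∂P = ∫ t in Ioo 0 T, η t * ∫ x, θ t x *
      (⟪u t x, FunctionSpaces.Torus.gradient g x⟫_ℝ + κ * FunctionSpaces.Torus.laplacian g x) := by
    rw [hP, integral_prod _ hf₂i]
    refine integral_congr_ae (Eventually.of_forall fun t => ?_)
    simp only [hf₂]
    exact integral_const_mul _ _
  have ha : Integrable (fun t => deriv η t * ∫ x, θ t x * g x) (volume.restrict (Ioo 0 T)) := by
    refine hf₁i.integral_prod_left.congr (Eventually.of_forall fun t => ?_)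
    simp only [hf₁]
    exact integral_const_mul _ _
  have hb : Integrable (fun t => η t * ∫ x, θ t x *
      (⟪u t x, FunctionSpaces.Torus.gradient g x⟫_ℝ + κ * FunctionSpaces.Torus.laplacian g x)) (volume.restrict (Ioo 0 T)) := by
    refine hf₂i.integral_prod_left.congr (Eventually.of_forall fun t => ?_)
    simp only [hf₂]
    exact integral_const_mul _ _
  rw [integral_add hf₁i hf₂i, e₁, e₂] at esum
  rw [integral_add ha hb]
  exact esum

end IsWeakScalarTransportOn

end WeakTest

/-! ## The Fourier modes of a weak solution -/

section ModeIdentity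

omit [Fintype d] in
/-- `r Re (w e) = Re ((r : ℂ) w e)`: moving a real factor inside the real part. [folklore] -/
theorem _root_.Literature.Analysis.FluidPDE.real_mul_re_mul (r : ℝ) (w e : ℂ) : r * (w * e).re = ((r : ℂ) * w * e).re := by
  rw [mul_assoc, Complex.re_ofReal_mul]

/-- Integrability of `f(x) Re (w e_{-k}(x))` for integrable real `f`. [folklore] -/
theorem integrable_mul_re_mul_mFourier {f : UnitAddTorus d → ℝ} (hf : Integrable f volume)
    (w : ℂ) (k : d → ℤ) : Integrable (fun x => f x * (w * mFourier (-k) x).re) volume := by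
  refine hf.mul_bdd (c := ‖w‖) ?_ (Eventually.of_forall fun x => ?_)
  · exact (Complex.continuous_re.comp (continuous_const.mul (mFourier (-k)).continuous)).aestronglyMeasurable
  · refine (Complex.abs_re_le_norm _).trans ?_
    rw [norm_mul]
    exact mul_le_of_le_one_right (norm_nonneg _)
      (((mFourier (-k)).norm_coe_le_norm x).trans_eq mFourier_norm)

namespace IsWeakScalarTransportOn

variable {T κ : ℝ} {u : ℝ → UnitAddTorus d → EuclideanSpace ℝ d} {θ₀ : UnitAddTorus d → ℝ}
  {θ : ℝ → UnitAddTorus d → ℝ}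

/-- Integrability on `(0,T) × T^d` of `e_{-k}(x) θ(t,x)`. [folklore] -/
theorem integrable_mFourier_mul (h : IsWeakScalarTransportOn T κ u θ₀ θ) (k : d → ℤ) :
    Integrable (fun p : ℝ × UnitAddTorus d => mFourier (-k) p.2 * (θ p.1 p.2 : ℂ))
      (((volume : Measure ℝ).restrict (Ioo 0 T)).prod volume) :=
  (ofRealCLM.integrable_comp h.integrable_uncurry).bdd_mul (c := 1)
    ((mFourier (-k)).continuous.comp continuous_snd).aestronglyMeasurable
    (Eventually.of_forall fun p => ((mFourier (-k)).norm_coe_le_norm p.2).trans_eq mFourier_norm)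

/-- The Fourier modes `t ↦ 𝓕(θ(t))(k)` of a weak solution are integrable on `(0,T)`
(`θ ∈ L¹((0,T) × T^d)` and Fubini). [folklore] -/
theorem integrableOn_mFourierCoeff (h : IsWeakScalarTransportOn T κ u θ₀ θ) (k : d → ℤ) :
    Integrable (fun t => mFourierCoeff (fun x => (θ t x : ℂ)) k) (volume.restrict (Ioo 0 T)) := by
  have e : (fun t => mFourierCoeff (fun x => (θ t x : ℂ)) k) =
      fun t => ∫ x, mFourier (-k) x * (θ t x : ℂ) := by
    funext t
    rw [FunctionSpaces.Torus.mFourierCoeff_eq_integral_volume]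
    rfl
  rw [e]
  exact (h.integrable_mFourier_mul k).integral_prod_left

/-- Joint measurability of the coordinate fluxes `θ uⱼ` on `(0,T) × T^d`. [folklore] -/
theorem aestronglyMeasurable_mul_velocity (h : IsWeakScalarTransportOn T κ u θ₀ θ) (j : d) :
    AEStronglyMeasurable (fun p : ℝ × UnitAddTorus d => θ p.1 p.2 * u p.1 p.2 j)
      (((volume : Measure ℝ).restrict (Ioo 0 T)).prod volume) :=
  h.aestronglyMeasurable_uncurry.mul
    ((EuclideanSpace.proj j).continuous.comp_aestronglyMeasurable h.aestronglyMeasurable_uncurry_velocity)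

/-- Integrability of the coordinate fluxes `θ uⱼ` on `(0,T) × T^d` (`|θ uⱼ| ≤ ‖u‖ |θ|`). [folklore] -/
theorem integrable_mul_velocity (h : IsWeakScalarTransportOn T κ u θ₀ θ) (j : d) :
    Integrable (fun p : ℝ × UnitAddTorus d => θ p.1 p.2 * u p.1 p.2 j)
      (((volume : Measure ℝ).restrict (Ioo 0 T)).prod volume) := by
  refine h.integrable_norm_velocity_mul.norm.mono' (h.aestronglyMeasurable_mul_velocity j)
    (Eventually.of_forall fun p => ?_)
  rw [norm_mul, norm_mul, norm_norm, Real.norm_eq_abs, Real.norm_eq_abs, mul_comm]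
  exact mul_le_mul_of_nonneg_right (FunctionSpaces.Torus.abs_apply_le_norm (u p.1 p.2) j) (abs_nonneg _)

/-- Integrability on `(0,T) × T^d` of `e_{-k}(x) θ(t,x) uⱼ(t,x)`. [folklore] -/
theorem integrable_mFourier_mul_mul_velocity (h : IsWeakScalarTransportOn T κ u θ₀ θ) (k : d → ℤ)
    (j : d) :
    Integrable (fun p : ℝ × UnitAddTorus d => mFourier (-k) p.2 * ((θ p.1 p.2 * u p.1 p.2 j : ℝ) : ℂ))
      (((volume : Measure ℝ).restrict (Ioo 0 T)).prod volume) :=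
  (ofRealCLM.integrable_comp (h.integrable_mul_velocity j)).bdd_mul (c := 1)
    ((mFourier (-k)).continuous.comp continuous_snd).aestronglyMeasurable
    (Eventually.of_forall fun p => ((mFourier (-k)).norm_coe_le_norm p.2).trans_eq mFourier_norm)

/-- The Fourier modes `t ↦ 𝓕(θ(t) uⱼ(t))(k)` of the fluxes are integrable on `(0,T)`
(`θ u ∈ L¹((0,T) × T^d)` and Fubini). [folklore] -/
theorem integrableOn_mFourierCoeff_mul_velocity (h : IsWeakScalarTransportOn T κ u θ₀ θ)
    (k : d → ℤ) (j : d) :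
    Integrable (fun t => mFourierCoeff (fun x => ((θ t x * u t x j : ℝ) : ℂ)) k)
      (volume.restrict (Ioo 0 T)) := by
  have e : (fun t => mFourierCoeff (fun x => ((θ t x * u t x j : ℝ) : ℂ)) k) =
      fun t => ∫ x, mFourier (-k) x * ((θ t x * u t x j : ℝ) : ℂ) := by
    funext t
    rw [FunctionSpaces.Torus.mFourierCoeff_eq_integral_volume]
    rfl
  rw [e]
  exact (h.integrable_mFourier_mul_mul_velocity k j).integral_prod_left

/-- For a.e. `t ∈ (0,T)`: `θ t` and all fluxes `θ t · uⱼ t` are integrable on `T^d`. [folklore] -/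
theorem ae_integrable_slice (h : IsWeakScalarTransportOn T κ u θ₀ θ) :
    ∀ᵐ t ∂(volume.restrict (Ioo 0 T)),
      Integrable (θ t) volume ∧ ∀ j, Integrable (fun x => θ t x * u t x j) volume := by
  have hall : ∀ᵐ t ∂(volume.restrict (Ioo 0 T)), ∀ j, Integrable (fun x => θ t x * u t x j) volume :=
    ae_all_iff.2 fun j => (h.integrable_mul_velocity j).prod_right_ae
  filter_upwards [h.ae_memLp_two, hall] with t ht hj
  exact ⟨ht.integrable one_le_two, hj⟩

/-- **The spatial pairings of a slice with the one-mode test function.** If `θ t` and the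
fluxes `θ t · uⱼ t` are integrable, then with `χ = Re (z e_{-k})`,
`∫ θ(t) (⟪u(t), ∇χ⟫ + κ Δχ) = Re (z (-4π²κ|k|² 𝓕θ(t)(k) - ∑ⱼ 2πi kⱼ 𝓕(θ uⱼ)(t)(k)))`. [folklore] -/
theorem integral_mul_flux_oneMode {t : ℝ} (hθt : Integrable (θ t) volume)
    (hju : ∀ j, Integrable (fun x => θ t x * u t x j) volume) (k : d → ℤ) (z : ℂ) :
    ∫ x, θ t x * (⟪u t x, FunctionSpaces.Torus.gradient (fun y : UnitAddTorus d => (FunctionSpaces.Torus.trigPoly {-k} (fun _ => z) y).re) x⟫_ℝ +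
      κ * FunctionSpaces.Torus.laplacian (fun y : UnitAddTorus d => (FunctionSpaces.Torus.trigPoly {-k} (fun _ => z) y).re) x) =
      (z * (-(((4 * Real.pi ^ 2 * κ * FunctionSpaces.Torus.freqNormSq k : ℝ)) : ℂ) * mFourierCoeff (fun x => (θ t x : ℂ)) k -
        ∑ j, (2 * Real.pi * I * (k j)) *
          mFourierCoeff (fun x => ((θ t x * u t x j : ℝ) : ℂ)) k)).re := by
  classical
  -- pointwise expansion of the integrand
  have hpt : ∀ x, θ t x * (⟪u t x, FunctionSpaces.Torus.gradient (fun y : UnitAddTorus d => (FunctionSpaces.Torus.trigPoly {-k} (fun _ => z) y).re) x⟫_ℝ +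
      κ * FunctionSpaces.Torus.laplacian (fun y : UnitAddTorus d => (FunctionSpaces.Torus.trigPoly {-k} (fun _ => z) y).re) x) =
      (∑ j, (θ t x * u t x j) * ((-(2 * Real.pi * I * (k j)) * z) * mFourier (-k) x).re) +
        θ t x * (((κ : ℂ) * (-((4 * Real.pi ^ 2 * FunctionSpaces.Torus.freqNormSq k : ℝ) : ℂ)) * z) * mFourier (-k) x).re := by
    intro x
    rw [inner_gradient_re_oneMode, laplacian_re_oneMode, Complex.re_sum, mul_add, Finset.mul_sum]
    congr 1
    · refine Finset.sum_congr rfl fun j _ => ?_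
      conv_lhs => rw [← Complex.re_ofReal_mul]
      conv_rhs => rw [real_mul_re_mul]
      congr 1
      push_cast
      ring
    · congr 1
      rw [real_mul_re_mul]
      congr 1
      ring
  simp_rw [hpt]
  have hi : ∀ j : d, Integrable (fun x => (θ t x * u t x j) *
      ((-(2 * Real.pi * I * (k j)) * z) * mFourier (-k) x).re) volume :=
    fun j => integrable_mul_re_mul_mFourier (hju j) _ k
  rw [integral_add (integrable_finsetSum _ fun j _ => hi j) (integrable_mul_re_mul_mFourier hθt _ k),
    integral_finsetSum _ fun j _ => hi j]
  simp_rw [integral_mul_re_mul_mFourier (hju _) _ k, integral_mul_re_mul_mFourier hθt _ k]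
  rw [← Complex.re_sum, ← Complex.add_re]
  congr 1
  have hs : ∑ j, -(2 * Real.pi * I * (k j)) * z * mFourierCoeff (fun x => ((θ t x * u t x j : ℝ) : ℂ)) k =
      -(z * ∑ j, (2 * Real.pi * I * (k j)) * mFourierCoeff (fun x => ((θ t x * u t x j : ℝ) : ℂ)) k) := by
    rw [Finset.mul_sum, ← Finset.sum_neg_distrib]
    exact Finset.sum_congr rfl fun j _ => by ring
  have ec : (((4 * Real.pi ^ 2 * κ * FunctionSpaces.Torus.freqNormSq k : ℝ)) : ℂ) =
      (κ : ℂ) * ((4 * Real.pi ^ 2 * FunctionSpaces.Torus.freqNormSq k : ℝ) : ℂ) := by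
    push_cast
    ring
  rw [hs, ec]
  ring

/-- Integrability on `(0,T)` of the modewise right-hand side
`-4π²κ|k|² 𝓕θ(t)(k) - ∑ⱼ 2πi kⱼ 𝓕(θ uⱼ)(t)(k)`. [folklore] -/
theorem integrableOn_modeRHS (h : IsWeakScalarTransportOn T κ u θ₀ θ) (k : d → ℤ) :
    Integrable (fun s => -(((4 * Real.pi ^ 2 * κ * FunctionSpaces.Torus.freqNormSq k : ℝ)) : ℂ) *
        mFourierCoeff (fun x => (θ s x : ℂ)) k -
      ∑ j, (2 * Real.pi * I * (k j)) * mFourierCoeff (fun x => ((θ s x * u s x j : ℝ) : ℂ)) k)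
      (volume.restrict (Ioo 0 T)) :=
  ((h.integrableOn_mFourierCoeff k).const_mul _).sub
    (integrable_finsetSum _ fun j _ => (h.integrableOn_mFourierCoeff_mul_velocity k j).const_mul _)

/-- **The modewise integral equation, tested form.** For every `k ∈ ℤ^d` and `z ∈ ℂ`, the real
function `t ↦ Re (z 𝓕θ(t)(k))` satisfies, for a.e. `t ∈ (0,T)`,
`Re (z 𝓕θ(t)(k)) = Re (z 𝓕θ₀(k)) + ∫_{(0,t]} Re (z (-4π²κ|k|² 𝓕θ(s)(k) - ∑ⱼ 2πi kⱼ 𝓕(θuⱼ)(s)(k))) ds`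
(the weak formulation tested with `η(t) Re (z e_{-k}(x))`, DiPerna–Lions 1989, (14), and the a.e.
du Bois-Reymond lemma with initial datum, `Literature.Analysis.FunctionSpaces.ae_eq_add_setIntegral_of_forall_test`). [folklore] -/
theorem ae_re_mul_mFourierCoeff_eq (h : IsWeakScalarTransportOn T κ u θ₀ θ)
    (hθ₀ : Integrable θ₀ volume) (k : d → ℤ) (z : ℂ) :
    ∀ᵐ t ∂(volume.restrict (Ioo 0 T)),
      (z * mFourierCoeff (fun x => (θ t x : ℂ)) k).re =
        (z * mFourierCoeff (fun x => (θ₀ x : ℂ)) k).re +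
        ∫ s in Ioc 0 t, (z * (-(((4 * Real.pi ^ 2 * κ * FunctionSpaces.Torus.freqNormSq k : ℝ)) : ℂ) *
            mFourierCoeff (fun x => (θ s x : ℂ)) k -
          ∑ j, (2 * Real.pi * I * (k j)) * mFourierCoeff (fun x => ((θ s x * u s x j : ℝ) : ℂ)) k)).re := by
  classical
  have hAi := h.integrableOn_mFourierCoeff k
  have hBi := h.integrableOn_modeRHS k
  refine FunctionSpaces.ae_eq_add_setIntegral_of_forall_test (hAi.const_mul z).re (hBi.const_mul z).re
    fun η hη hηc hηT => ?_
  have key := h.setIntegral_test_mul hη hηc hηT (FunctionSpaces.Torus.isSmooth_re_trigPoly {-k} (fun _ => z))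
  rw [integral_mul_re_oneMode hθ₀] at key
  have hae : ∀ᵐ s ∂(volume.restrict (Ioo 0 T)),
      (deriv η s * ∫ x, θ s x * (FunctionSpaces.Torus.trigPoly {-k} (fun _ => z) x).re) +
        η s * ∫ x, θ s x *
          (⟪u s x, FunctionSpaces.Torus.gradient (fun y : UnitAddTorus d => (FunctionSpaces.Torus.trigPoly {-k} (fun _ => z) y).re) x⟫_ℝ +
            κ * FunctionSpaces.Torus.laplacian (fun y : UnitAddTorus d => (FunctionSpaces.Torus.trigPoly {-k} (fun _ => z) y).re) x) =
      deriv η s * (z * mFourierCoeff (fun x => (θ s x : ℂ)) k).re +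
        η s * (z * (-(((4 * Real.pi ^ 2 * κ * FunctionSpaces.Torus.freqNormSq k : ℝ)) : ℂ) *
            mFourierCoeff (fun x => (θ s x : ℂ)) k -
          ∑ j, (2 * Real.pi * I * (k j)) *
            mFourierCoeff (fun x => ((θ s x * u s x j : ℝ) : ℂ)) k)).re := by
    filter_upwards [h.ae_integrable_slice] with s hs
    rw [integral_mul_re_oneMode hs.1, integral_mul_flux_oneMode hs.1 hs.2]
  rw [integral_congr_ae hae] at key
  exact key

/-- Real part of an integral of a complex integrable function. [folklore] -/
theorem _root_.Literature.Analysis.FluidPDE.re_integral_eq {α : Type*} [MeasurableSpace α] {μ : Measure α} {f : α → ℂ}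
    (hf : Integrable f μ) : (∫ x, f x ∂μ).re = ∫ x, (f x).re ∂μ := by
  have h := integral_re hf
  simp only [RCLike.re_to_complex] at h
  exact h.symm

/-- Imaginary part of an integral of a complex integrable function. [folklore] -/
theorem _root_.Literature.Analysis.FluidPDE.im_integral_eq {α : Type*} [MeasurableSpace α] {μ : Measure α} {f : α → ℂ}
    (hf : Integrable f μ) : (∫ x, f x ∂μ).im = ∫ x, (f x).im ∂μ := by
  have h := integral_im hf
  simp only [RCLike.im_to_complex] at h
  exact h.symm

/-- **The Fourier modes of a weak solution solve the Galerkin ODEs in integrated form.** For a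
weak solution `θ ∈ L^∞(0,T; L²(T^d))` of `∂ₜθ + u·∇θ = κΔθ` with datum `θ₀ ∈ L¹` and every
`k ∈ ℤ^d`: for a.e. `t ∈ (0,T)`,
`𝓕θ(t)(k) = 𝓕θ₀(k) + ∫_{(0,t]} (-4π²κ|k|² 𝓕θ(s)(k) - ∑ⱼ 2πi kⱼ 𝓕(θ uⱼ)(s)(k)) ds`,
i.e. `d/dt θ̂(k) = -4π²κ|k|² θ̂(k) - (div (uθ))^(k)`, `θ̂(k)(0) = θ̂₀(k)` in the sense of
distributions on `[0,T)` (the weak formulation, DiPerna–Lions 1989, (14) / Evans 2010, §7.1.2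
(16), tested against the characters; real and imaginary parts from
`ae_re_mul_mFourierCoeff_eq` with `z = 1, i`). [cite: DiPernaLions1989, §II.1 (14)] -/
theorem ae_mFourierCoeff_eq (h : IsWeakScalarTransportOn T κ u θ₀ θ) (hθ₀ : Integrable θ₀ volume)
    (k : d → ℤ) :
    ∀ᵐ t ∂(volume.restrict (Ioo 0 T)),
      mFourierCoeff (fun x => (θ t x : ℂ)) k = mFourierCoeff (fun x => (θ₀ x : ℂ)) k +
        ∫ s in Ioc 0 t, (-(((4 * Real.pi ^ 2 * κ * FunctionSpaces.Torus.freqNormSq k : ℝ)) : ℂ) *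
            mFourierCoeff (fun x => (θ s x : ℂ)) k -
          ∑ j, (2 * Real.pi * I * (k j)) * mFourierCoeff (fun x => ((θ s x * u s x j : ℝ) : ℂ)) k) := by
  have hBi := h.integrableOn_modeRHS k
  classical
  filter_upwards [h.ae_re_mul_mFourierCoeff_eq hθ₀ k 1, h.ae_re_mul_mFourierCoeff_eq hθ₀ k I,
    ae_restrict_mem measurableSet_Ioo] with t h1 hI ht
  have hBt := (show IntegrableOn _ (Ioo 0 T) volume from hBi).mono_set (Ioc_subset_Ioo_right ht.2)
  simp only [one_mul] at h1
  simp only [I_mul_re] at hI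
  rw [integral_neg, ← neg_add, neg_inj] at hI
  apply Complex.ext
  · rw [h1, Complex.add_re, re_integral_eq hBt]
  · rw [hI, Complex.add_im, im_integral_eq hBt]

end IsWeakScalarTransportOn

end ModeIdentity

end Torus

end Literature.Analysis.FluidPDE
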